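import Summits.MatrixMultiplication.MatrixMultiplication.Theorems.SoloInformedValFamilyCriterion

/-!
# The half-volume lemma for coset difference sets

Setting of `SoloInformedValFamilyCriterion` (finite abelian group, identity potentials, a family of complete blocks,
the family criterion `M_t ⊥ U_t ⊥ V_t`).

`two_mul_card_sumSet_le_of_coset`: if `D ⊆ G` is closed under `d₁ − d₂ + d₃` (i.e. `D` is empty or a coset of the
subgroup `D − D`) and some translate `X + c` is disjoint from `X + D`, then `2·|X + D| ≤ |G|` — because `X + D` is
saturated under `D − D`, so the whole translate `X + D + (c − d₀)` is disjoint from it as well.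

`FamilyCriterionAt.two_mul_volume_le_of_coset`: consequently, in a family satisfying the criterion at block `t`, if the
`JK`-difference set `Y_t − Z_t` is a coset and another block `u ≠ t` has nonempty `Y_u`, `Z_u`, then
`2·|X_t||Y_t||Z_t| ≤ |G|` (the translate `X_t + (y_u − z_u)` lies in `U_t`, which is disjoint from `M_t = X_t + (Y_t − Z_t)`).
`NoAccidental.two_mul_volume_le_of_coset` is the accidental-free form.

Consequence recorded in the dossier: 'pure subspace' unions of complete blocks (all difference sets cosets) have every
block volume at most `|G|/2`, hence `T³ ≤ (r/4)·|G|²·I·J·K` when every row lies in `r` blocks — no such design with rows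
in at most four blocks beats `T³ ≤ |G|²·I·J·K`.
-/

namespace Summit.MatrixMultiplication.MatrixMultiplication.Theorems.SoloVal

open Finset

section HalfVolume

variable {G : Type*} [AddCommGroup G] [DecidableEq G]

/-- The mixed image `X + Y − Z` is the sumset of `X` with the difference set `Y − Z`. -/
theorem mixedImage_eq_sumSet_diffSet (X Y Z : Finset G) :
    mixedImage X Y Z = sumSet X (diffSet Y Z) := by
  ext g
  rw [mem_mixedImage, mem_sumSet]
  constructor
  · rintro ⟨x, hx, y, hy, z, hz, rfl⟩
    exact ⟨x, hx, y - z, mem_diffSet.mpr ⟨y, hy, z, hz, rfl⟩, by abel⟩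
  · rintro ⟨x, hx, d, hd, rfl⟩
    obtain ⟨y, hy, z, hz, rfl⟩ := mem_diffSet.mp hd
    exact ⟨x, hx, y, hy, z, hz, by abel⟩

/-- THE HALF-VOLUME LEMMA (set form). If `D` is closed under `d₁ − d₂ + d₃` (a coset of `D − D`, or empty) and a
translate `X + c` is disjoint from `X + D`, then `2·|X + D| ≤ |G|`. -/
theorem two_mul_card_sumSet_le_of_coset [Fintype G] {X D : Finset G}
    (hD : ∀ d₁ ∈ D, ∀ d₂ ∈ D, ∀ d₃ ∈ D, d₁ - d₂ + d₃ ∈ D) (c : G)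
    (hc : Disjoint (sumSet X D) (X.image fun x => x + c)) :
    2 * (sumSet X D).card ≤ Fintype.card G := by
  rcases D.eq_empty_or_nonempty with hDe | ⟨d₀, hd₀⟩
  · have h0 : sumSet X D = ∅ := by
      rw [hDe]; unfold sumSet; simp
    rw [h0, Finset.card_empty]; exact Nat.zero_le _
  -- the translate `X + D + (c - d₀)` is disjoint from `X + D`
  set M := sumSet X D with hM
  have hdisj : Disjoint M (M.image fun m => m + (c - d₀)) := by
    rw [Finset.disjoint_left]
    intro m hm hm'
    obtain ⟨m₁, hm₁, hmeq⟩ := Finset.mem_image.mp hm'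
    obtain ⟨x, hx, d, hd, rfl⟩ := mem_sumSet.mp hm
    obtain ⟨x₁, hx₁, d₁, hd₁, rfl⟩ := mem_sumSet.mp hm₁
    -- then `x₁ + c = x + (d - d₁ + d₀) ∈ X + D`, contradicting `hc`
    have hin : x₁ + c ∈ sumSet X D :=
      mem_sumSet.mpr ⟨x, hx, d - d₁ + d₀, hD d hd d₁ hd₁ d₀ hd₀, by
        have h := hmeq
        -- h : x₁ + d₁ + (c - d₀) = x + d
        calc x + (d - d₁ + d₀) = (x + d) - d₁ + d₀ := by abel
          _ = (x₁ + d₁ + (c - d₀)) - d₁ + d₀ := by rw [h]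
          _ = x₁ + c := by abel⟩
    exact Finset.disjoint_left.mp hc hin (Finset.mem_image.mpr ⟨x₁, hx₁, rfl⟩)
  have hcard : (M.image fun m => m + (c - d₀)).card = M.card :=
    Finset.card_image_of_injective _ (add_left_injective (c - d₀))
  calc 2 * M.card = M.card + (M.image fun m => m + (c - d₀)).card := by rw [hcard]; ring
    _ = (M ∪ M.image fun m => m + (c - d₀)).card := (Finset.card_union_of_disjoint hdisj).symm
    _ ≤ Fintype.card G := Finset.card_le_univ _

variable {ι : Type*} [DecidableEq ι]
variable {T : Finset ι} {X Y Z : ι → Finset G} {t u : ι}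

/-- THE HALF-VOLUME LEMMA (block form). Under the family criterion at `t`: if `Y_t − Z_t` is a coset (closed under
`d₁ − d₂ + d₃`) and another block `u ≠ t` of the family has nonempty `Y_u` and `Z_u`, then `2·|X_t||Y_t||Z_t| ≤ |G|`. -/
theorem FamilyCriterionAt.two_mul_volume_le_of_coset [Fintype G] (h : FamilyCriterionAt T X Y Z t)
    (hcoset : ∀ d₁ ∈ diffSet (Y t) (Z t), ∀ d₂ ∈ diffSet (Y t) (Z t), ∀ d₃ ∈ diffSet (Y t) (Z t),
      d₁ - d₂ + d₃ ∈ diffSet (Y t) (Z t))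
    (hu : u ∈ T) (hut : u ≠ t) (hYu : (Y u).Nonempty) (hZu : (Z u).Nonempty) :
    2 * ((X t).card * (Y t).card * (Z t).card) ≤ Fintype.card G := by
  obtain ⟨y, hy⟩ := hYu
  obtain ⟨z, hz⟩ := hZu
  obtain ⟨hT, hMU, -, -⟩ := h
  rw [← hT.card_mixedImage, mixedImage_eq_sumSet_diffSet]
  refine two_mul_card_sumSet_le_of_coset hcoset (y - z) ?_
  -- `X_t + (y - z) ⊆ U_t`, and `M_t ⊥ U_t`
  rw [mixedImage_eq_sumSet_diffSet] at hMU
  refine Finset.disjoint_of_subset_right ?_ hMU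
  intro g hg
  obtain ⟨x, hx, rfl⟩ := Finset.mem_image.mp hg
  exact mem_crossU.mpr ⟨x, hx, u, Finset.mem_erase.mpr ⟨hut, hu⟩, y, hy, z, hz, rfl⟩

/-- The half-volume lemma for an accidental-free family with pairwise disjoint `Y`- and `Z`-classes: a block whose
`JK`-difference set is a coset has volume at most `|G|/2` as soon as another block of the family is nonempty in
`Y` and `Z`. -/
theorem NoAccidental.two_mul_volume_le_of_coset [Fintype G]
    (hY : ∀ a ∈ T, ∀ b ∈ T, a ≠ b → Disjoint (Y a) (Y b))
    (hZ : ∀ a ∈ T, ∀ b ∈ T, a ≠ b → Disjoint (Z a) (Z b))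
    (hN : NoAccidental (id : G → G) id id (famPairs T X Y) (famPairs T Y Z) (famPairs T Z X))
    (ht : t ∈ T)
    (hcoset : ∀ d₁ ∈ diffSet (Y t) (Z t), ∀ d₂ ∈ diffSet (Y t) (Z t), ∀ d₃ ∈ diffSet (Y t) (Z t),
      d₁ - d₂ + d₃ ∈ diffSet (Y t) (Z t))
    (hu : u ∈ T) (hut : u ≠ t) (hYu : (Y u).Nonempty) (hZu : (Z u).Nonempty) :
    2 * ((X t).card * (Y t).card * (Z t).card) ≤ Fintype.card G :=
  (familyCriterion_of_noAccidental hY hZ hN ht).two_mul_volume_le_of_coset hcoset hu hut hYu hZu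

end HalfVolume

end Summit.MatrixMultiplication.MatrixMultiplication.Theorems.SoloVal
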